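import Summits.QuantumFields.YangMills.Theorems.BalabanUVNodesN22AtRateRecord13
import Summits.QuantumFields.YangMills.Theorems.BalabanUVNodesRateCarriersOfRecord13CoPR
import Summits.QuantumFields.YangMills.Theorems.BalabanUVNodesN22AtRecordTowerKeyed
import Summits.QuantumFields.YangMills.Theorems.BalabanUVNodesN22AtRecordStrip
import Summits.QuantumFields.YangMills.Theorems.BalabanUVNodesN22AtRecordAnalytic

/-!
# v1.6 `CoPR` EDITION (RUN-INDEXED RESIDUAL 𝐓-WEIGHTS, FINDING №8) of 9″a — N22 AT THE HOME: slots (O)∕(A)∕(A′), the edge N18 → N22 at the home, the spineRates hooks.  The `CoP ↦ CoPR` image of this seat's v1.5 module `BalabanUVNodesN22AtRateRecord13CoP` (p524726).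
#
# WHY THIS FILE EXISTS (director-ym LINE №169 H1 ∕ №173 ∕ ★ №174 PRESS WORD «v1.6 → rev 22 is authorised … pens port their OWN files by token», pub-ymgap INBOX l.19279;
# node00-def-T INTENT-25∕26T l.19481 + FILED-25 l.19522; dag-lead DEDUP-286 l.19497; plan g69 PREPRESS-22 l.19542).  FINDING №8 (def-T LOCATED-8, ref-D GATE-(g1) REAL,
# dag-n11-d (★) not provable): the v1.5 record held the residual part of print's 𝐓-weights ζ(Ω^c_{k+1}) ([Balaban1988Convergent] (1.11) p.248, (3.16)–(3.20)
# pp.268–269) in a slot `θ.Zt K` indexed by the run LENGTH `K` alone, NARROWER than print (the weights of a run depend on the run's own sequence of restrictions);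
# def-T's FILE 25 `Node00/Record13CoPR` (p529474) therefore introduced `structure Stage13RParams extends Stage13Params` with ONE new RUN-INDEXED field
# `Zr : (p : B12.RunParams) → TkResidualW Fam N (FluctV N) p.K`, the guard `Stage13RParams.ZrUnity` (print's partition of unity, replacing 12b's `ZtUnity`), the proviso
# core `Stage13RParams.Provisos₁₃CoPR` (v1.2's `Provisos₁₃Core` rows verbatim at `θ.toStage13Params` + `zrLaws ∕ zrLocal`), the datum `datumOfRecord₁₃CoPR F N θ h` and the
# record class `IsRecordOfRecord₁₃CCoPR` (+ the one-way run-blind embedding `Stage13RParams.ofRunBlind` from v1.5); RR-2 re-keyed the datum key on it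
# (`Node00/Record13DatumKeyCoPR`, p?: `IsDatumOfRecord₁₃CCoPR ∕ CCoPROn ∕ CCoPRN`, `IsRecordOfRecord₁₃CCoPROn ∕ CCoPRN`, the guard of record `unityNondeg₁₃R`); plan presses rev 22
# (⁶ = T₆(⁵): the four cruxes re-minted over `Stage13RParams`, K3⁶ `SpineGivenEndpointR13SepCoPR`).  A theorem binding `θ : Stage13Params` cannot be applied at a
# `Stage13RParams` item tuple's datum (another datum), so every storey typed `∀ (θ : Stage13Params F N) (hc : θ.Provisos₁₃Core F N), …` is re-keyed ONCE MORE; this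
# file is the (T-RATE) pen's image of its own v1.5 module under def-T's KEY-RULE-25 (= dag-lead's WORDS-142 legend), token for token:
#   binder `Stage13Params ↦ Stage13RParams` (the readings `lit ∕ ne1`, the residual maps `w1 ∕ ℓ₃ ∕ ne2`, the regimes `Rg` and the selectors `ksel` are typed over
#   `Stage13RParams`) · `θ.Provisos₁₃Core ↦ θ.Provisos₁₃CoPR` · `datumOfRecord₁₃CoP ↦ datumOfRecord₁₃CoPR` · `(Is|is)DatumOfRecord₁₃CCoP(On|N) ↦ …₁₃CCoPR(On|N)` ·
#   `(Is|is)RecordOfRecord₁₃CCoP(On|N) ↦ …₁₃CCoPR(On|N)` · guard `θ.ZtUnity ↦ θ.ZrUnity`, `Node00.unityNondeg₁₃ ↦ Node00.unityNondeg₁₃R` · THIS seat's stems `…₁₃CoP… ↦ …₁₃CoPR…`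
#   (`RateReading₁₃CoPR`, `rateCarriersOfRecord₁₃CoPR`, `RRec₁₃CoPR(On)`, `rRec₁₃CoPR…`, `readingOfRecord₁₃CoPR`, `…datumKey₁₃CoPR…`, `n22_tupleReadingOfRecordCoPR(On)…`) and
#   module names `…13CoP… ↦ …13CoPR…`;
#   SITE-RULE (KEY-RULE-25: `X F N θ ↦ X F N θ.toStage13Params` for every θ-level X NOT re-issued — the rate objects read NO 𝐓-weight slot): the ‴ bundle
#   `u3OfRecord₁₃ θ u k ↦ u3OfRecord₁₃ θ.toStage13Params u k` (its faces `u3OfRecord₁₃_W ∕ _γ ∕ _Λ ∕ _C ∕ _EA ∕ _EB ∕ _eq_u3OfRecord₁₂ ∕ _eq_toStage11 ∕ fadingMemory_u3OfRecord₁₃ ∕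
#   n22At_u3OfRecord₁₃_iff ∕ u3OfRecord₁₃_objects` and every θ-form closer `n22At_u3OfRecord₁₃_…` of the ‴ modules are applied AT `θ.toStage13Params`, imported BY NAME
#   from the ‴ original this module imports); the parent views `θ.toStage12Params ∕ θ.γ ∕ θ.L`, `θ.Admissible F N`, `θ.SlotsNondegenerate₁₃ F N` resolve through
#   `extends` (unchanged text).
# Statements = the v1.5 statements under the map, proofs = the v1.5 proofs verbatim (kernel re-derivations BY NAME); the ‴ ∕ ⁗ ∕ Co ∕ CoP editions of this module stay
# in the tree as the aside items' context (nothing landed is edited or re-declared).  bg-BLIND and 𝐓-WEIGHT-BLIND: like its predecessors, nothing here reads any FIELD of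
# the proviso or the slot `θ.Zr` — they enter only as the binder TYPES of the readings and through RR-2's key — which is why the port is a token map.
#
# ITEM IDS: crux names ∕ item ids quoted in the ‴ header of record below (K0‴–K3‴ = stmt-QuantumFields-19909…19912, `Record13Inhabited`, `SpineGivenEndpointR13`; in
# places the ⁵ ids) are those of EARLIER revisions, asides since rev 22∕23; this file is filed `--supports stmt-QuantumFields-20509` (K3⁶ `SpineGivenEndpointR13SepCoPR`, the K3 item of
# record per dag-lead's KEY MAP WORDS-142, pub-ymgap INBOX l.19649) as a HELPER — count-neutral, no stub closed, N22 NOT discharged, no inhabitant of any key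
# claimed (K0 OPEN at every edition), nothing of Bałaban asserted; one finite 𝕋⁴ programme at fixed ε — NOT continuum ∕ OS ∕ mass-gap ∕ Clay.
#
# ‴ HEADER OF RECORD FOLLOWS (token-mapped; its decl lists are this file's, the θ-only names above excepted):
#
# BalabanUVNodes ∕ node N22 = NE9 ∧ fading memory AT THE STAGE-13 RATE-RECORD HOME `YMDAG.UVSplit.RRec₁₃CoPR 𝔯` — N22's K4 stub BY NAME at `Record13`:
# from NE9 alone (fading memory is the letter block's shape), from node N18's stub on a tower reading in the three regularity currencies (R₂) ∕ (A′) ∕ (A), from the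
# three abstract slots at every run length, and K4's ∀-packaged hook at the per-level home

Track A of `YM-PLAN.md` (cell `pub-ymgap`, HUMAN RULING D-0062), R134 seat `pub-ymgap-dag-n22-e` (s2 «`FadingMemory` by name from a modulus + knit at the record»),
gen 5, module 9″a = the Stage-13 twin (`12 ↦ 13`) of the lineage's module 2 `…N22AtRateRecord12.lean` (p466533) at the record OF RECORD (director-ym LINE №125 «RECORD 13»
∕ №133: route rev 16 ∕ 17, K3‴ `SpineGivenEndpointR13` = stmt-QuantumFields-19912 over `Node00.Stage13Params F 2`; dag-lead KEY TABLE WORDS-133 ∕ 134 ∕ 135).  THEOREMS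
ONLY; imports layer B at ₁₃ (`…RateCarriersOfRecord13`: `RRec₁₃CoPR`, `u3OfRecord₁₃`, `rateCarriersOfRecord₁₃CoPR`, faces; `u3OfRecord₁₃_eq_u3OfRecord₁₂` ∕ `_eq_toStage11` make
every θ-generic Stage-11 ∕ 12 slot closer apply verbatim) + the lineage's stage-free closers (`…N22AtRecordTowerKeyed` p452282: `s_N22_of_s_N18_towerKeyed{,_strip,_analytic}`;
`…N22AtRecordStrip` p428115: `n22At_of_oscStrip`; `…N22AtRecordAnalytic` p421057: `n22At_of_oscAnalytic`; `…N22AtRecord` p419962: `n22At_of_oscSecondDiff`); every proof is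
ONE application BY NAME.  COUNT-NEUTRAL; `--supports` K3‴ (stmt-QuantumFields-19912) as a helper.  Restate-immune (no Theses import).

WHAT IS KERNEL-CHECKED ([folklore] bookkeeping; 0 `def`, 0 `sorry`; the Stage-12 list under `12 ↦ 13`).
* §1 `s_N22_rRec₁₃CoPR_of_ne9` — N22's stub at the home from NE9 of the level functionals ALONE under the letter signs (θ-form over `(θ : Stage13RParams F N, hP : θ.Provisos₁₃CoPR F N)`);
  `s_N22_rRec₁₃CoPR_of_forall_admissible` (θ-form transfer), `s_N22_rRec₁₃CoPR_iff_of_u3_agree`, `s_N22_rRec₁₃CoPR_of_pin` (locality in the U3 component).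
* §2 the three ABSTRACT SLOTS at the Stage-13 bundle `u3OfRecord₁₃ θ.toStage13Params u k`: `n22At_u3OfRecord₁₃_of_oscStrip ∕ _oscAnalytic ∕ _oscSecondDiff`, and at the record (θ-form):
  `s_N22_rRec₁₃CoPR_of_oscStrip ∕ _oscAnalytic ∕ _oscSecondDiff`.
* §3 THE EDGE N18 → N22 AT THE HOME on a tower reading: `s_N22_rRec₁₃CoPR_of_s_N18` (R₂), `s_N22_rRec₁₃CoPR_of_s_N18_strip` (A′), `s_N22_rRec₁₃CoPR_of_s_N18_analytic` (A) — p452282's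
  tower-keyed closers at `RRec := RRec₁₃CoPR 𝔯` with `RRec₁₃CoPR.other_level` and the bundle literal `u3OfRecord₁₃_objects`.
* §4 K4's ∀-PACKAGED HOOK at the per-level home from the six stubs (`spineRates_rRec₁₃CoPR_of_forall`), from five stubs + N22's regularity letter with N17 glued
  (`spineRates_rRec₁₃CoPR_of_towerReading`), and at the Stage-13 record class (`spineRates_rec13CCoPR_rRec₁₃CoPR_of_forall`).

HONEST FRAMING.  Every hypothesis below is a residual estimate on the READING `𝔯` (NE9 ∕ the oscillation, analyticity, second-difference letters of node U3's level
functionals; node N18's stub) with NO producer at any named reading today; `𝔯` is a PARAMETER; nothing of Bałaban's is asserted or instantiated — NE9 is NOT PRINTED for d = 4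
(«OBJECT-bound»; [Balaban1987RG1] p. 263 states C^∞ «(or analytic)» dependence in the LAST coupling only) and NOT PROVED; no inhabitant of `IsDatumOfRecord₁₃CCoPR` is claimed
(K0‴ `Record13Inhabited`, stmt-QuantumFields-19909, OPEN); N22 is NOT discharged; counts UNMOVED (typed 28∕28 · discharged 5∕27, A 5∕28); one finite four-torus programme at
fixed `ε` — NOT ℝ⁴, NOT infinite volume, NOT OS, NOT a mass gap, NOT Clay.  No decl below carries a cite tag.
-/

noncomputable section

namespace YMDAG.N22

open Set Metric
open scoped BigOperators
open Literature.MathematicalPhysics.QuantumFieldTheory.Balaban1983to89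
open Literature.MathematicalPhysics.QuantumFieldTheory.Balaban1983to89.T4Continuum
open Literature.MathematicalPhysics.QuantumFieldTheory.Balaban1983to89.T4OutputRate
open Literature.MathematicalPhysics.QuantumFieldTheory.Balaban1983to89.Node00 (Stage13RParams IsDatumOfRecord₁₃CCoPR U3Objects₁₁ U3Tower₁₁ U3Letters₁₁)
open Summit.QuantumFields.BalabanUV.T4Continuum.NE9.TowerCarriers (TowerData prepend)
open YMDAG.UVSplit

variable {N : ℕ} [NeZero N]

/-! ## §1 N22's stub at the Stage-13 home is «NE9 at every level» under the letter signs -/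

section Reading

variable (𝔯 : RateReading₁₃CoPR N)

/-- **N22 AT THE STAGE-13 HOME FROM NE9 ALONE (θ-form).**  If the reading's letter block carries its displayed signs and, at EVERY admissible Stage-13 tuple with provisos,
every `(g₀, os)` and every run length `k`, the level functional `(𝔯.lit F θ hP g₀ os).u3.EA k` has the joint history-Lipschitz bound NE9 on `]0, θ.γ]` with the moduli
OF RECORD `C₉·ω^{k−i}`, then `S_N22 (RRec₁₃CoPR 𝔯)` — fading memory is the letter block's shape (`fadingMemory_u3OfRecord₁₃`). [folklore] -/
theorem s_N22_rRec₁₃CoPR_of_ne9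
    (hs : ∀ (F : T4Family) (θ : Stage13RParams F N) (hP : θ.Provisos₁₃CoPR F N), θ.Admissible F N → ∀ (g₀ : ℕ → ℝ) (os : List (ULoop F)),
      (𝔯.lit F θ hP g₀ os).u3.Signs)
    (h9 : ∀ (F : T4Family) (θ : Stage13RParams F N) (hP : θ.Provisos₁₃CoPR F N), θ.Admissible F N → ∀ (g₀ : ℕ → ℝ) (os : List (ULoop F)) (k : ℕ),
      NE9 ((𝔯.lit F θ hP g₀ os).u3.EA k) (Window θ.γ) (𝔯.lit F θ hP g₀ os).u3.κ (𝔯.lit F θ hP g₀ os).u3.moduli) :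
    S_N22 (RRec₁₃CoPR 𝔯) := by
  rw [s_N22_rRec₁₃CoPR_iff]
  intro F D h g₀ os k
  exact (n22At_u3OfRecord₁₃_iff h.params.toStage13Params _ k (hs F h.params h.provisos h.admissible g₀ os)).mpr
    (h9 F h.params h.provisos h.admissible g₀ os k)

/-- **N22 AT THE STAGE-13 HOME, θ-FORM**: `N22At` at every run length of the reading's U3 objects at EVERY admissible Stage-13 tuple with provisos gives the stub
(`forall_datumKey₁₃CoPR_of_forall_admissible`'s pattern, one application). [folklore] -/
theorem s_N22_rRec₁₃CoPR_of_forall_admissible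
    (h22 : ∀ (F : T4Family) (θ : Stage13RParams F N) (hP : θ.Provisos₁₃CoPR F N), θ.Admissible F N → ∀ (g₀ : ℕ → ℝ) (os : List (ULoop F)) (k : ℕ),
      N22At (u3OfRecord₁₃ θ.toStage13Params (𝔯.lit F θ hP g₀ os).u3 k)) :
    S_N22 (RRec₁₃CoPR 𝔯) := by
  rw [s_N22_rRec₁₃CoPR_iff]
  intro F D h g₀ os k
  exact h22 F h.params h.provisos h.admissible g₀ os k

/-- **COMPONENT LOCALITY**: two Stage-13 readings whose U3 OBJECTS AGREE on the admissible tuples with provisos have THE SAME `S_N22 (RRec₁₃CoPR ·)` — the dressed tower `ne1` and the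
single-scale layers `ne2 ∕ ne3` are IDLE for N22 (layer B's `rRec₁₃CoPR_congr` restricted to the one component N22 reads). [folklore] -/
theorem s_N22_rRec₁₃CoPR_iff_of_u3_agree {𝔯 𝔯' : RateReading₁₃CoPR N}
    (hu3 : ∀ (F : T4Family) (θ : Stage13RParams F N) (hP : θ.Provisos₁₃CoPR F N), θ.Admissible F N → ∀ (g₀ : ℕ → ℝ) (os : List (ULoop F)),
      (𝔯.lit F θ hP g₀ os).u3 = (𝔯'.lit F θ hP g₀ os).u3) :
    S_N22 (RRec₁₃CoPR 𝔯) ↔ S_N22 (RRec₁₃CoPR 𝔯') := by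
  rw [s_N22_rRec₁₃CoPR_iff, s_N22_rRec₁₃CoPR_iff]
  refine forall_congr' fun F => forall_congr' fun D => forall_congr' fun h => forall_congr' fun g₀ => forall_congr' fun os =>
    forall_congr' fun k => ?_
  rw [hu3 F h.params h.provisos h.admissible g₀ os]

/-- **THE PIN SHAPE** (where a definer's NAMED U3 assignment — node00-def-W1's `𝔯_W1` component — and an estimate seat's ∀θ theorem meet): if the reading's U3 objects ARE
`pin F θ hP g₀ os` on the admissible tuples with provisos and `N22At` holds at every run length of `pin`'s bundles there, then `S_N22 (RRec₁₃CoPR 𝔯)`. [folklore] -/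
theorem s_N22_rRec₁₃CoPR_of_pin (pin : (F : T4Family) → (θ : Stage13RParams F N) → θ.Provisos₁₃CoPR F N → (ℕ → ℝ) → List (ULoop F) → U3Objects₁₁)
    (hpin : ∀ (F : T4Family) (θ : Stage13RParams F N) (hP : θ.Provisos₁₃CoPR F N), θ.Admissible F N → ∀ (g₀ : ℕ → ℝ) (os : List (ULoop F)),
      (𝔯.lit F θ hP g₀ os).u3 = pin F θ hP g₀ os)
    (h22 : ∀ (F : T4Family) (θ : Stage13RParams F N) (hP : θ.Provisos₁₃CoPR F N), θ.Admissible F N → ∀ (g₀ : ℕ → ℝ) (os : List (ULoop F)) (k : ℕ),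
      N22At (u3OfRecord₁₃ θ.toStage13Params (pin F θ hP g₀ os) k)) :
    S_N22 (RRec₁₃CoPR 𝔯) :=
  s_N22_rRec₁₃CoPR_of_forall_admissible 𝔯 fun F θ hP hθ g₀ os k => by
    rw [hpin F θ hP hθ g₀ os]
    exact h22 F θ hP hθ g₀ os k

end Reading

section Slots

variable (𝔯 : RateReading₁₃CoPR N)

/-- **`S_N22 (RRec₁₃CoPR 𝔯)` FROM THE STRIP SLOT (A′) AT EVERY RUN LENGTH** of the reading's U3 objects, at every admissible Stage-13 tuple with provisos (θ-form; the slot's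
constants `C₀ L μ r s` may depend on everything). [folklore] -/
theorem s_N22_rRec₁₃CoPR_of_oscStrip
    (hslot : ∀ (F : T4Family) (θ : Stage13RParams F N) (hP : θ.Provisos₁₃CoPR F N), θ.Admissible F N → ∀ (g₀ : ℕ → ℝ) (os : List (ULoop F)) (k : ℕ),
      ∃ C₀ L μ r s : ℝ,
        PrefixDependenceOn ((𝔯.lit F θ hP g₀ os).u3.EA k) (Window θ.γ) ∧
        (∀ g ∈ Window θ.γ, ∀ g' ∈ Window θ.γ, ∀ (U : ((𝔯.lit F θ hP g₀ os).u3.levelCarriers k).BgA) (X : ((𝔯.lit F θ hP g₀ os).u3.levelCarriers k).Dom)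
          (a : ℕ), a ≤ ((𝔯.lit F θ hP g₀ os).u3.levelCarriers k).scale X → (∀ n, a ≤ n → g n = g' n) →
            |(𝔯.lit F θ hP g₀ os).u3.EA k g U X - (𝔯.lit F θ hP g₀ os).u3.EA k g' U X| ≤
              C₀ * (𝔯.lit F θ hP g₀ os).u3.θ₅ ^ (((𝔯.lit F θ hP g₀ os).u3.levelCarriers k).scale X - a) *
                Real.exp (-((𝔯.lit F θ hP g₀ os).u3.κ * ((𝔯.lit F θ hP g₀ os).u3.levelCarriers k).d X))) ∧
        (∀ g ∈ Window θ.γ, ∀ (U : ((𝔯.lit F θ hP g₀ os).u3.levelCarriers k).BgA) (X : ((𝔯.lit F θ hP g₀ os).u3.levelCarriers k).Dom) (i : ℕ),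
          i < ((𝔯.lit F θ hP g₀ os).u3.levelCarriers k).scale X → ∃ (Fz : ℂ → ℂ) (Dset : Set ℂ), DifferentiableOn ℂ Fz Dset ∧
            (∀ z ∈ Dset, ‖deriv Fz z‖ ≤ L * μ ^ (((𝔯.lit F θ hP g₀ os).u3.levelCarriers k).scale X - 1 - i) *
              Real.exp (-((𝔯.lit F θ hP g₀ os).u3.κ * ((𝔯.lit F θ hP g₀ os).u3.levelCarriers k).d X))) ∧
            (∀ t ∈ Ioc (0 : ℝ) θ.γ, ball (t : ℂ) r ⊆ Dset) ∧
            (∀ t ∈ Ioc (0 : ℝ) θ.γ, Fz t = ((𝔯.lit F θ hP g₀ os).u3.EA k (Function.update g i t) U X : ℂ))) ∧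
        0 < C₀ ∧ 0 < (𝔯.lit F θ hP g₀ os).u3.θ₅ ∧ 0 < L ∧ (𝔯.lit F θ hP g₀ os).u3.θ₅ ≤ μ ∧ C₀ ≤ 2 * (L * r) ∧ 0 < r ∧ 0 < s ∧ s < 1 ∧
        (𝔯.lit F θ hP g₀ os).u3.ω = (𝔯.lit F θ hP g₀ os).u3.θ₅ ^ (1 - s) * μ ^ s ∧
        (𝔯.lit F θ hP g₀ os).u3.C₉ = 32 / (s ^ 2 * min (r / 2) (θ.γ / 2)) * (C₀ ^ (1 - s) * (2 * (L * r)) ^ s) /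
          ((𝔯.lit F θ hP g₀ os).u3.θ₅ ^ (1 - s) * μ ^ s)) :
    S_N22 (RRec₁₃CoPR 𝔯) := by
  rw [s_N22_rRec₁₃CoPR_iff]
  intro F D h g₀ os k
  obtain ⟨C₀, L, μ, r, s, hP, hO, hA, hC₀, hθ, hL, hθμ, hCL, hr, hs0, hs1, hω, hC₉⟩ := hslot F h.params h.provisos h.admissible g₀ os k
  exact n22At_u3OfRecord₁₃_of_oscStrip h.params.toStage13Params _ k hP hO hA hC₀ hθ hL hθμ hCL hr h.gamma_pos hs0 hs1 hω hC₉

/-- **`S_N22 (RRec₁₃CoPR 𝔯)` FROM THE ANALYTIC SLOT (A) AT EVERY RUN LENGTH** (θ-form). [folklore] -/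
theorem s_N22_rRec₁₃CoPR_of_oscAnalytic
    (hslot : ∀ (F : T4Family) (θ : Stage13RParams F N) (hP : θ.Provisos₁₃CoPR F N), θ.Admissible F N → ∀ (g₀ : ℕ → ℝ) (os : List (ULoop F)) (k : ℕ),
      ∃ C₀ M μ r s : ℝ,
        PrefixDependenceOn ((𝔯.lit F θ hP g₀ os).u3.EA k) (Window θ.γ) ∧
        (∀ g ∈ Window θ.γ, ∀ g' ∈ Window θ.γ, ∀ (U : ((𝔯.lit F θ hP g₀ os).u3.levelCarriers k).BgA) (X : ((𝔯.lit F θ hP g₀ os).u3.levelCarriers k).Dom)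
          (a : ℕ), a ≤ ((𝔯.lit F θ hP g₀ os).u3.levelCarriers k).scale X → (∀ n, a ≤ n → g n = g' n) →
            |(𝔯.lit F θ hP g₀ os).u3.EA k g U X - (𝔯.lit F θ hP g₀ os).u3.EA k g' U X| ≤
              C₀ * (𝔯.lit F θ hP g₀ os).u3.θ₅ ^ (((𝔯.lit F θ hP g₀ os).u3.levelCarriers k).scale X - a) *
                Real.exp (-((𝔯.lit F θ hP g₀ os).u3.κ * ((𝔯.lit F θ hP g₀ os).u3.levelCarriers k).d X))) ∧
        (∀ g ∈ Window θ.γ, ∀ (U : ((𝔯.lit F θ hP g₀ os).u3.levelCarriers k).BgA) (X : ((𝔯.lit F θ hP g₀ os).u3.levelCarriers k).Dom) (i : ℕ),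
          i < ((𝔯.lit F θ hP g₀ os).u3.levelCarriers k).scale X → ∃ (Fz : ℂ → ℂ) (Dset : Set ℂ), DifferentiableOn ℂ Fz Dset ∧
            (∀ z ∈ Dset, ‖Fz z‖ ≤ M * μ ^ (((𝔯.lit F θ hP g₀ os).u3.levelCarriers k).scale X - 1 - i) *
              Real.exp (-((𝔯.lit F θ hP g₀ os).u3.κ * ((𝔯.lit F θ hP g₀ os).u3.levelCarriers k).d X))) ∧
            (∀ t ∈ Ioc (0 : ℝ) θ.γ, closedBall (t : ℂ) r ⊆ Dset) ∧
            (∀ t ∈ Ioc (0 : ℝ) θ.γ, Fz t = ((𝔯.lit F θ hP g₀ os).u3.EA k (Function.update g i t) U X : ℂ))) ∧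
        0 < C₀ ∧ 0 < (𝔯.lit F θ hP g₀ os).u3.θ₅ ∧ 0 < M ∧ (𝔯.lit F θ hP g₀ os).u3.θ₅ ≤ μ ∧ C₀ ≤ 2 * M ∧ 0 < r ∧ 0 < s ∧ s < 1 ∧
        (𝔯.lit F θ hP g₀ os).u3.ω = (𝔯.lit F θ hP g₀ os).u3.θ₅ ^ (1 - s) * μ ^ s ∧
        (𝔯.lit F θ hP g₀ os).u3.C₉ = 32 / (s ^ 2 * min (r / 2) (θ.γ / 2)) * (C₀ ^ (1 - s) * (2 * M) ^ s) /
          ((𝔯.lit F θ hP g₀ os).u3.θ₅ ^ (1 - s) * μ ^ s)) :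
    S_N22 (RRec₁₃CoPR 𝔯) := by
  rw [s_N22_rRec₁₃CoPR_iff]
  intro F D h g₀ os k
  obtain ⟨C₀, M, μ, r, s, hP, hO, hA, hC₀, hθ, hM, hθμ, hCM, hr, hs0, hs1, hω, hC₉⟩ := hslot F h.params h.provisos h.admissible g₀ os k
  exact n22At_u3OfRecord₁₃_of_oscAnalytic h.params.toStage13Params _ k hP hO hA hC₀ hθ hM hθμ hCM hr h.gamma_pos hs0 hs1 hω hC₉

/-- **`S_N22 (RRec₁₃CoPR 𝔯)` FROM THE SECOND-DIFFERENCE SLOT (R₂) AT EVERY RUN LENGTH** (θ-form). [folklore] -/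
theorem s_N22_rRec₁₃CoPR_of_oscSecondDiff
    (hslot : ∀ (F : T4Family) (θ : Stage13RParams F N) (hP : θ.Provisos₁₃CoPR F N), θ.Admissible F N → ∀ (g₀ : ℕ → ℝ) (os : List (ULoop F)) (k : ℕ),
      ∃ C₀ M μ ρ : ℝ,
        PrefixDependenceOn ((𝔯.lit F θ hP g₀ os).u3.EA k) (Window θ.γ) ∧
        (∀ g ∈ Window θ.γ, ∀ g' ∈ Window θ.γ, ∀ (U : ((𝔯.lit F θ hP g₀ os).u3.levelCarriers k).BgA) (X : ((𝔯.lit F θ hP g₀ os).u3.levelCarriers k).Dom)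
          (a : ℕ), a ≤ ((𝔯.lit F θ hP g₀ os).u3.levelCarriers k).scale X → (∀ n, a ≤ n → g n = g' n) →
            |(𝔯.lit F θ hP g₀ os).u3.EA k g U X - (𝔯.lit F θ hP g₀ os).u3.EA k g' U X| ≤
              C₀ * (𝔯.lit F θ hP g₀ os).u3.θ₅ ^ (((𝔯.lit F θ hP g₀ os).u3.levelCarriers k).scale X - a) *
                Real.exp (-((𝔯.lit F θ hP g₀ os).u3.κ * ((𝔯.lit F θ hP g₀ os).u3.levelCarriers k).d X))) ∧
        (∀ g ∈ Window θ.γ, ∀ (U : ((𝔯.lit F θ hP g₀ os).u3.levelCarriers k).BgA) (X : ((𝔯.lit F θ hP g₀ os).u3.levelCarriers k).Dom) (i : ℕ),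
          i < ((𝔯.lit F θ hP g₀ os).u3.levelCarriers k).scale X → ∀ t d : ℝ, 0 < d → t - d ∈ Ioc (0 : ℝ) θ.γ → t + d ∈ Ioc (0 : ℝ) θ.γ →
            |(𝔯.lit F θ hP g₀ os).u3.EA k (Function.update g i (t + d)) U X - 2 * (𝔯.lit F θ hP g₀ os).u3.EA k (Function.update g i t) U X +
                (𝔯.lit F θ hP g₀ os).u3.EA k (Function.update g i (t - d)) U X| ≤
              M * μ ^ (((𝔯.lit F θ hP g₀ os).u3.levelCarriers k).scale X - 1 - i) *
                Real.exp (-((𝔯.lit F θ hP g₀ os).u3.κ * ((𝔯.lit F θ hP g₀ os).u3.levelCarriers k).d X)) * d ^ 2) ∧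
        0 ≤ C₀ ∧ 0 ≤ (𝔯.lit F θ hP g₀ os).u3.θ₅ ∧ 0 ≤ M ∧ 0 ≤ μ ∧ 0 < ρ ∧ ρ ≤ 1 ∧
        (𝔯.lit F θ hP g₀ os).u3.θ₅ ≤ (𝔯.lit F θ hP g₀ os).u3.ω * ρ ∧ μ * ρ ≤ (𝔯.lit F θ hP g₀ os).u3.ω ∧ 0 < (𝔯.lit F θ hP g₀ os).u3.ω ∧
        (𝔯.lit F θ hP g₀ os).u3.C₉ = (4 * C₀ / θ.γ + M * θ.γ / 2) / (𝔯.lit F θ hP g₀ os).u3.ω) :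
    S_N22 (RRec₁₃CoPR 𝔯) := by
  rw [s_N22_rRec₁₃CoPR_iff]
  intro F D h g₀ os k
  obtain ⟨C₀, M, μ, ρ, hP, hO, hR2, hC₀, hθ0, hM, hμ, hρ0, hρ1, hθωρ, hμρω, hω0, hC₉⟩ := hslot F h.params h.provisos h.admissible g₀ os k
  exact n22At_u3OfRecord₁₃_of_oscSecondDiff h.params.toStage13Params _ k hP hO hR2 hC₀ hθ0 hM hμ h.gamma_pos hρ0 hρ1 hθωρ hμρω hω0 hC₉

end Slots

/-! ## §3 The edge N18 → N22 at the Stage-13 home on a tower reading, in the three regularity currencies -/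

section Edge

variable (𝔯 : RateReading₁₃CoPR N)

/-- **`S_N18 (RRec₁₃CoPR 𝔯) → S_N22 (RRec₁₃CoPR 𝔯)` FOR A TOWER READING WITH (P) + (R₂) AT EVERY LEVEL.**  Hypotheses (displayed): at every admissible Stage-13 tuple with provisos and
every `(g₀, os)`, node U3's objects of the reading ARE a tower reading `t.objects ℓ` with `0 ≤ ℓ.C₅`, `0 ≤ ℓ.θ₅ < 1`, every level functional `t.E k` has (P) prefix dependence
on `]0, θ.γ]` and second differences of its young-coupling sections bounded by `M·μ^{age−1}·e^{−ℓ.κ·d}·d²`, and `0 ≤ M`, `0 ≤ μ`, `0 < ρ ≤ 1`, `ℓ.θ₅ ≤ ℓ.ω·ρ`, `μρ ≤ ℓ.ω`,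
`0 < ℓ.ω`, `ℓ.C₉ = (4·(2ℓ.C₅∕(1−ℓ.θ₅))∕θ.γ + M·θ.γ∕2)∕ℓ.ω` (the home DEFINES `C₉` by this formula).  Then node N18's stub at the home gives node N22's: every other run
length is a bundle of record at the same datum (`RRec₁₃CoPR.other_level`), so p452282's `s_N22_of_s_N18_towerKeyed` applies with the bundle literal `u3OfRecord₁₃_objects`.
[folklore] -/
theorem s_N22_rRec₁₃CoPR_of_s_N18 (h18 : S_N18 (RRec₁₃CoPR 𝔯))
    (htow : ∀ (F : T4Family) (θ : Stage13RParams F N) (hP : θ.Provisos₁₃CoPR F N), θ.Admissible F N → ∀ (g₀ : ℕ → ℝ) (os : List (ULoop F)),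
      ∃ (t : U3Tower₁₁) (ℓ : U3Letters₁₁) (M μ ρ : ℝ), (𝔯.lit F θ hP g₀ os).u3 = t.objects ℓ ∧ 0 ≤ ℓ.C₅ ∧ 0 ≤ ℓ.θ₅ ∧ ℓ.θ₅ < 1 ∧
        (∀ k : ℕ, PrefixDependenceOn (C := (towerData₁₁ t).level k) (t.E k) (Window θ.γ)) ∧
        (∀ k : ℕ, ∀ g ∈ Window θ.γ, ∀ (U : ((towerData₁₁ t).level k).BgA) (X : ((towerData₁₁ t).level k).Dom) (i : ℕ),
          i < ((towerData₁₁ t).level k).scale X → ∀ a d : ℝ, 0 < d → a - d ∈ Ioc (0 : ℝ) θ.γ → a + d ∈ Ioc (0 : ℝ) θ.γ →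
            |t.E k (Function.update g i (a + d)) U X - 2 * t.E k (Function.update g i a) U X + t.E k (Function.update g i (a - d)) U X| ≤
              M * μ ^ (((towerData₁₁ t).level k).scale X - 1 - i) * Real.exp (-(ℓ.κ * ((towerData₁₁ t).level k).d X)) * d ^ 2) ∧
        0 ≤ M ∧ 0 ≤ μ ∧ 0 < ρ ∧ ρ ≤ 1 ∧ ℓ.θ₅ ≤ ℓ.ω * ρ ∧ μ * ρ ≤ ℓ.ω ∧ 0 < ℓ.ω ∧
        ℓ.C₉ = (4 * (2 * ℓ.C₅ / (1 - ℓ.θ₅)) / θ.γ + M * θ.γ / 2) / ℓ.ω) :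
    S_N22 (RRec₁₃CoPR 𝔯) := by
  refine s_N22_of_s_N18_towerKeyed (RRec₁₃CoPR 𝔯) h18 ?_
  rintro F D g₀ os R ⟨h, k, rfl⟩
  obtain ⟨t, ℓ, M, μ, ρ, hu, hC, hθ0, hθ1, hP, hR2, hM, hμ, hρ0, hρ1, hθτρ, hμρτ, hτ0, hC₉⟩ :=
    htow F h.params h.provisos h.admissible g₀ os
  refine ⟨towerData₁₁ t, t.E, h.params.γ, ℓ.κ, ℓ.θ₅, ℓ.C₅, M, μ, ρ, ℓ.ω, ℓ.cr, ℓ.ρ, k, ?_, hC, hθ0, hθ1, ?_, hP k, hR2 k, hM, hμ,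
    h.gamma_pos, hρ0, hρ1, hθτρ, hμρτ, hτ0⟩
  · show u3OfRecord₁₃ h.params.toStage13Params (𝔯.lit F h.params h.provisos g₀ os).u3 k = _
    rw [hu, u3OfRecord₁₃_objects, ← hC₉]
  · intro k' _
    refine ⟨rateCarriersOfRecord₁₃CoPR 𝔯 F h.params h.provisos g₀ os k', fun a i => ℓ.C₉ * ℓ.ω ^ (a - i), ℓ.C₉, ℓ.ω, ℓ.cr, ℓ.ρ, ⟨h, k', rfl⟩, ?_⟩
    show u3OfRecord₁₃ h.params.toStage13Params (𝔯.lit F h.params h.provisos g₀ os).u3 k' = _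
    rw [hu, u3OfRecord₁₃_objects]

/-- **`S_N18 (RRec₁₃CoPR 𝔯) → S_N22 (RRec₁₃CoPR 𝔯)` FOR A TOWER READING WITH (P) + (A′) AT EVERY LEVEL** (ROAD 3 in the strip ∕ derivative-letter currency): as above with `0 < ℓ.C₅`,
`0 < ℓ.θ₅ < 1`, ONE complex-differentiable extension per young-coupling section of `t.E k` on a set containing the open `r`-discs about `]0, θ.γ]` with the derivative letter
`L·μ^{age−1}·e^{−ℓ.κ·d}` (`0 < L`, `ℓ.θ₅ ≤ μ`, `2ℓ.C₅∕(1−ℓ.θ₅) ≤ 2Lr`, `0 < r`, `0 < s < 1`), and the letter equations `ℓ.ω = ℓ.θ₅^{1−s}μ^{s}`,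
`ℓ.C₉ = (32∕(s²·min(r∕2, θ.γ∕2)))·(2ℓ.C₅∕(1−ℓ.θ₅))^{1−s}(2(Lr))^{s}∕(ℓ.θ₅^{1−s}μ^{s})` — via p452282's `s_N22_of_s_N18_towerKeyed_strip`. [folklore] -/
theorem s_N22_rRec₁₃CoPR_of_s_N18_strip (h18 : S_N18 (RRec₁₃CoPR 𝔯))
    (htow : ∀ (F : T4Family) (θ : Stage13RParams F N) (hP : θ.Provisos₁₃CoPR F N), θ.Admissible F N → ∀ (g₀ : ℕ → ℝ) (os : List (ULoop F)),
      ∃ (t : U3Tower₁₁) (ℓ : U3Letters₁₁) (L μ r s : ℝ), (𝔯.lit F θ hP g₀ os).u3 = t.objects ℓ ∧ 0 < ℓ.C₅ ∧ 0 < ℓ.θ₅ ∧ ℓ.θ₅ < 1 ∧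
        (∀ k : ℕ, PrefixDependenceOn (C := (towerData₁₁ t).level k) (t.E k) (Window θ.γ)) ∧
        (∀ k : ℕ, ∀ g ∈ Window θ.γ, ∀ (U : ((towerData₁₁ t).level k).BgA) (X : ((towerData₁₁ t).level k).Dom) (i : ℕ),
          i < ((towerData₁₁ t).level k).scale X → ∃ (Fz : ℂ → ℂ) (Dset : Set ℂ), DifferentiableOn ℂ Fz Dset ∧
            (∀ z ∈ Dset, ‖deriv Fz z‖ ≤ L * μ ^ (((towerData₁₁ t).level k).scale X - 1 - i) * Real.exp (-(ℓ.κ * ((towerData₁₁ t).level k).d X))) ∧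
            (∀ a ∈ Ioc (0 : ℝ) θ.γ, ball (a : ℂ) r ⊆ Dset) ∧ (∀ a ∈ Ioc (0 : ℝ) θ.γ, Fz a = (t.E k (Function.update g i a) U X : ℂ))) ∧
        0 < L ∧ ℓ.θ₅ ≤ μ ∧ 2 * ℓ.C₅ / (1 - ℓ.θ₅) ≤ 2 * (L * r) ∧ 0 < r ∧ 0 < s ∧ s < 1 ∧
        ℓ.ω = ℓ.θ₅ ^ (1 - s) * μ ^ s ∧
        ℓ.C₉ = 32 / (s ^ 2 * min (r / 2) (θ.γ / 2)) * ((2 * ℓ.C₅ / (1 - ℓ.θ₅)) ^ (1 - s) * (2 * (L * r)) ^ s) / (ℓ.θ₅ ^ (1 - s) * μ ^ s)) :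
    S_N22 (RRec₁₃CoPR 𝔯) := by
  refine s_N22_of_s_N18_towerKeyed_strip (RRec₁₃CoPR 𝔯) h18 ?_
  rintro F D g₀ os R ⟨h, k, rfl⟩
  obtain ⟨t, ℓ, L, μ, r, s, hu, hC, hθ0, hθ1, hP, hA, hL, hθμ, hCL, hr, hs0, hs1, hω, hC₉⟩ :=
    htow F h.params h.provisos h.admissible g₀ os
  refine ⟨towerData₁₁ t, t.E, h.params.γ, ℓ.κ, ℓ.θ₅, ℓ.C₅, L, μ, r, s, ℓ.cr, ℓ.ρ, k, ?_, hC, hθ0, hθ1, ?_, hP k, hA k, hL, hθμ, hCL, hr,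
    h.gamma_pos, hs0, hs1⟩
  · show u3OfRecord₁₃ h.params.toStage13Params (𝔯.lit F h.params h.provisos g₀ os).u3 k = _
    rw [hu, u3OfRecord₁₃_objects, ← hC₉, ← hω]
  · intro k' _
    refine ⟨rateCarriersOfRecord₁₃CoPR 𝔯 F h.params h.provisos g₀ os k', fun a i => ℓ.C₉ * ℓ.ω ^ (a - i), ℓ.C₉, ℓ.ω, ℓ.cr, ℓ.ρ, ⟨h, k', rfl⟩, ?_⟩
    show u3OfRecord₁₃ h.params.toStage13Params (𝔯.lit F h.params h.provisos g₀ os).u3 k' = _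
    rw [hu, u3OfRecord₁₃_objects]

/-- **`S_N18 (RRec₁₃CoPR 𝔯) → S_N22 (RRec₁₃CoPR 𝔯)` FOR A TOWER READING WITH (P) + (A) AT EVERY LEVEL** (ROAD 3, sup-letter currency — printed TYPE «(or analytic)» [Balaban1987RG1] p. 263
for the last coupling): a complex-differentiable extension of every young-coupling section of `t.E k` on a set containing the CLOSED `r`-discs about `]0, θ.γ]` with the sup
letter `M·μ^{age−1}·e^{−ℓ.κ·d}` (`0 < M`, `ℓ.θ₅ ≤ μ`, `2ℓ.C₅∕(1−ℓ.θ₅) ≤ 2M`, `0 < r`, `0 < s < 1`), letter equations `ℓ.ω = ℓ.θ₅^{1−s}μ^{s}`,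
`ℓ.C₉ = (32∕(s²·min(r∕2, θ.γ∕2)))·(2ℓ.C₅∕(1−ℓ.θ₅))^{1−s}(2M)^{s}∕(ℓ.θ₅^{1−s}μ^{s})` — via p452282's `s_N22_of_s_N18_towerKeyed_analytic`. [folklore] -/
theorem s_N22_rRec₁₃CoPR_of_s_N18_analytic (h18 : S_N18 (RRec₁₃CoPR 𝔯))
    (htow : ∀ (F : T4Family) (θ : Stage13RParams F N) (hP : θ.Provisos₁₃CoPR F N), θ.Admissible F N → ∀ (g₀ : ℕ → ℝ) (os : List (ULoop F)),
      ∃ (t : U3Tower₁₁) (ℓ : U3Letters₁₁) (M μ r s : ℝ), (𝔯.lit F θ hP g₀ os).u3 = t.objects ℓ ∧ 0 < ℓ.C₅ ∧ 0 < ℓ.θ₅ ∧ ℓ.θ₅ < 1 ∧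
        (∀ k : ℕ, PrefixDependenceOn (C := (towerData₁₁ t).level k) (t.E k) (Window θ.γ)) ∧
        (∀ k : ℕ, ∀ g ∈ Window θ.γ, ∀ (U : ((towerData₁₁ t).level k).BgA) (X : ((towerData₁₁ t).level k).Dom) (i : ℕ),
          i < ((towerData₁₁ t).level k).scale X → ∃ (Fz : ℂ → ℂ) (Dset : Set ℂ), DifferentiableOn ℂ Fz Dset ∧
            (∀ z ∈ Dset, ‖Fz z‖ ≤ M * μ ^ (((towerData₁₁ t).level k).scale X - 1 - i) * Real.exp (-(ℓ.κ * ((towerData₁₁ t).level k).d X))) ∧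
            (∀ a ∈ Ioc (0 : ℝ) θ.γ, closedBall (a : ℂ) r ⊆ Dset) ∧ (∀ a ∈ Ioc (0 : ℝ) θ.γ, Fz a = (t.E k (Function.update g i a) U X : ℂ))) ∧
        0 < M ∧ ℓ.θ₅ ≤ μ ∧ 2 * ℓ.C₅ / (1 - ℓ.θ₅) ≤ 2 * M ∧ 0 < r ∧ 0 < s ∧ s < 1 ∧
        ℓ.ω = ℓ.θ₅ ^ (1 - s) * μ ^ s ∧
        ℓ.C₉ = 32 / (s ^ 2 * min (r / 2) (θ.γ / 2)) * ((2 * ℓ.C₅ / (1 - ℓ.θ₅)) ^ (1 - s) * (2 * M) ^ s) / (ℓ.θ₅ ^ (1 - s) * μ ^ s)) :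
    S_N22 (RRec₁₃CoPR 𝔯) := by
  refine s_N22_of_s_N18_towerKeyed_analytic (RRec₁₃CoPR 𝔯) h18 ?_
  rintro F D g₀ os R ⟨h, k, rfl⟩
  obtain ⟨t, ℓ, M, μ, r, s, hu, hC, hθ0, hθ1, hP, hA, hM, hθμ, hCM, hr, hs0, hs1, hω, hC₉⟩ :=
    htow F h.params h.provisos h.admissible g₀ os
  refine ⟨towerData₁₁ t, t.E, h.params.γ, ℓ.κ, ℓ.θ₅, ℓ.C₅, M, μ, r, s, ℓ.cr, ℓ.ρ, k, ?_, hC, hθ0, hθ1, ?_, hP k, hA k, hM, hθμ, hCM, hr,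
    h.gamma_pos, hs0, hs1⟩
  · show u3OfRecord₁₃ h.params.toStage13Params (𝔯.lit F h.params h.provisos g₀ os).u3 k = _
    rw [hu, u3OfRecord₁₃_objects, ← hC₉, ← hω]
  · intro k' _
    refine ⟨rateCarriersOfRecord₁₃CoPR 𝔯 F h.params h.provisos g₀ os k', fun a i => ℓ.C₉ * ℓ.ω ^ (a - i), ℓ.C₉, ℓ.ω, ℓ.cr, ℓ.ρ, ⟨h, k', rfl⟩, ?_⟩
    show u3OfRecord₁₃ h.params.toStage13Params (𝔯.lit F h.params h.provisos g₀ os).u3 k' = _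
    rw [hu, u3OfRecord₁₃_objects]

end Edge

/-! ## §4 K4's hook at the per-level Stage-13 home is the ∀-PACKAGING `RateInputsAll (RRec₁₃CoPR 𝔯)`; the joins by name -/

section Hook

variable (𝔯 : RateReading₁₃CoPR N)

/-- **K4's CONCLUSION HOOK AT THE STAGE-13 HOME, ∀-PACKAGED, FROM THE SIX STUBS** (the route's `YMDAG.UVSplit.SpineRates_of_forall` at `RRec := RRec₁₃CoPR 𝔯`, any record predicate
`Rec` — K3‴ reads `Rec := Node00.IsRecordOfRecord₁₃CCoPR F N`): `SpineRates Rec (RateInputsAll (RRec₁₃CoPR 𝔯))` — K5's N19 stub then reads `S_N19 SRec (RateInputsAll (RRec₁₃CoPR 𝔯))`,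
i.e. the rates at every run length (`rateInputsAll_rRec₁₃CoPR_iff`). [folklore] -/
theorem spineRates_rRec₁₃CoPR_of_forall (Rec : RecordPred N) (h14 : S_N14 (RRec₁₃CoPR 𝔯)) (h15 : S_N15 (RRec₁₃CoPR 𝔯)) (h16 : S_N16 (RRec₁₃CoPR 𝔯))
    (h17 : S_N17 (RRec₁₃CoPR 𝔯)) (h18 : S_N18 (RRec₁₃CoPR 𝔯)) (h22 : S_N22 (RRec₁₃CoPR 𝔯)) : SpineRates Rec (RateInputsAll (RRec₁₃CoPR 𝔯)) :=
  SpineRates_of_forall Rec (RRec₁₃CoPR 𝔯) h14 h15 h16 h17 h18 h22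

/-- **… WITH N17 GLUED AND N22 DERIVED FROM N18 ON A TOWER READING** — the Stage-13 home's K4 hook from FIVE stubs (N14, N15, N16, N18, D4) plus N22's regularity letter (§3's
(R₂) hypotheses): `N17_of_U3edge` glues N17, `s_N22_rRec₁₃CoPR_of_s_N18` derives N22. [folklore] -/
theorem spineRates_rRec₁₃CoPR_of_towerReading (Rec : RecordPred N) (h14 : S_N14 (RRec₁₃CoPR 𝔯)) (h15 : S_N15 (RRec₁₃CoPR 𝔯)) (h16 : S_N16 (RRec₁₃CoPR 𝔯))
    (h18 : S_N18 (RRec₁₃CoPR 𝔯)) (hD4 : S_D4 (RRec₁₃CoPR 𝔯))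
    (htow : ∀ (F : T4Family) (θ : Stage13RParams F N) (hP : θ.Provisos₁₃CoPR F N), θ.Admissible F N → ∀ (g₀ : ℕ → ℝ) (os : List (ULoop F)),
      ∃ (t : U3Tower₁₁) (ℓ : U3Letters₁₁) (M μ ρ : ℝ), (𝔯.lit F θ hP g₀ os).u3 = t.objects ℓ ∧ 0 ≤ ℓ.C₅ ∧ 0 ≤ ℓ.θ₅ ∧ ℓ.θ₅ < 1 ∧
        (∀ k : ℕ, PrefixDependenceOn (C := (towerData₁₁ t).level k) (t.E k) (Window θ.γ)) ∧
        (∀ k : ℕ, ∀ g ∈ Window θ.γ, ∀ (U : ((towerData₁₁ t).level k).BgA) (X : ((towerData₁₁ t).level k).Dom) (i : ℕ),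
          i < ((towerData₁₁ t).level k).scale X → ∀ a d : ℝ, 0 < d → a - d ∈ Ioc (0 : ℝ) θ.γ → a + d ∈ Ioc (0 : ℝ) θ.γ →
            |t.E k (Function.update g i (a + d)) U X - 2 * t.E k (Function.update g i a) U X + t.E k (Function.update g i (a - d)) U X| ≤
              M * μ ^ (((towerData₁₁ t).level k).scale X - 1 - i) * Real.exp (-(ℓ.κ * ((towerData₁₁ t).level k).d X)) * d ^ 2) ∧
        0 ≤ M ∧ 0 ≤ μ ∧ 0 < ρ ∧ ρ ≤ 1 ∧ ℓ.θ₅ ≤ ℓ.ω * ρ ∧ μ * ρ ≤ ℓ.ω ∧ 0 < ℓ.ω ∧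
        ℓ.C₉ = (4 * (2 * ℓ.C₅ / (1 - ℓ.θ₅)) / θ.γ + M * θ.γ / 2) / ℓ.ω) :
    SpineRates Rec (RateInputsAll (RRec₁₃CoPR 𝔯)) :=
  have h22 : S_N22 (RRec₁₃CoPR 𝔯) := s_N22_rRec₁₃CoPR_of_s_N18 𝔯 h18 htow
  SpineRates_of_forall Rec (RRec₁₃CoPR 𝔯) h14 h15 h16 (N17_of_U3edge (RRec₁₃CoPR 𝔯) hD4 h18 h22) h18 h22

/-- **… IN PARTICULAR AT K3‴'s RECORD PREDICATE** `Rec := Node00.IsRecordOfRecord₁₃CCoPR F N`: the six stubs at the Stage-13 home give K4's ∀-hook, and its ∃-hook too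
(`spineRates_exists_of_forall` with `s_R00x_rRec₁₃CoPR` — existence is free at the home). [folklore] -/
theorem spineRates_rec13CCoPR_rRec₁₃CoPR_of_forall (h14 : S_N14 (RRec₁₃CoPR 𝔯)) (h15 : S_N15 (RRec₁₃CoPR 𝔯)) (h16 : S_N16 (RRec₁₃CoPR 𝔯)) (h17 : S_N17 (RRec₁₃CoPR 𝔯))
    (h18 : S_N18 (RRec₁₃CoPR 𝔯)) (h22 : S_N22 (RRec₁₃CoPR 𝔯)) :
    SpineRates (fun F D w => Node00.IsRecordOfRecord₁₃CCoPR F N D w) (RateInputsAll (RRec₁₃CoPR 𝔯)) ∧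
      SpineRates (fun F D w => Node00.IsRecordOfRecord₁₃CCoPR F N D w) (RateInputs (RRec₁₃CoPR 𝔯)) :=
  have hall := spineRates_rRec₁₃CoPR_of_forall 𝔯 (fun F D w => Node00.IsRecordOfRecord₁₃CCoPR F N D w) h14 h15 h16 h17 h18 h22
  ⟨hall, spineRates_exists_of_forall _ (RRec₁₃CoPR 𝔯) (s_R00x_rRec₁₃CoPR 𝔯) hall⟩

end Hook

end YMDAG.N22

end
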